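import Mathlib
import Summits.NavierStokesRegularity.NavierStokesRegularity.Theorems.TaoLadderRungThreeRestartControl
import Summits.NavierStokesRegularity.NavierStokesRegularity.Theses.TrappingWindowRungThree
import Summits.NavierStokesRegularity.NavierStokesRegularity.Theses.ExactWindowRungThree
import HarnessLib

/-!
# `TrappingWindowRungThree.RestartControl` = `ExactWindowRungThree.RestartControl`
  (item stmt-NavierStokesRegularity-21750, wanted by both routes)

The support `RestartControl` of routes `TrappingWindowRungThree` and `ExactWindowRungThree` is,
character for character, the shared support `RestartControl` of routes `TaoLadderRungThree` /
`TaoLadderRungTwo` / `TaoLadderRungTwoPoly` (items stmt-NavierStokesRegularity-20424 / 20650),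
already proved in the tree as `Theorems.RestartControl.main`
(file `TaoLadderRungThreeRestartControl.lean`): Tao's scale covariance at a checkpoint — the family
restarted at checkpoint `(N, t_N, e_N)` of a local pseudo-solution is an `(η, η)`-`PseudoFlowOn`
from the rescaled checkpoint state with admissible slack `restartSlack ≤ η · slackWeight`, for all
levels `n₀ ≥ N₀(K₁, K₂)`. This file closes the new item in BOTH route readings by that theorem.

HONEST FRAMING: bookkeeping about Tao-type MODEL lattice pseudo-flows (Tao 2016 §6.4); nothing
here is a statement about the Navier–Stokes equations, and the routes' rung leaf
(`TaoLadderRungThree.Target`, TL-M3) is not the summit Statement.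
-/

noncomputable section

set_option linter.dupNamespace false

namespace Summit.NavierStokesRegularity.NavierStokesRegularity.Theorems

open RestartControl in
/-- **Item stmt-NavierStokesRegularity-21750** read in route `TrappingWindowRungThree`
(`TrappingWindowRungThree.RestartControl`): Tao's scale covariance at a checkpoint with small
defects and admissible slack, closed by the tree theorem `RestartControl.main`.
[cite: Tao2016AveragedNS, §6.4 Prop. 6.5 and Lemma 6.7] -/
theorem trappingWindowRungThree_restartControl_proof :
    Summit.NavierStokesRegularity.NavierStokesRegularity.Theses.TrappingWindowRungThree.RestartControl := by
  unfold Summit.NavierStokesRegularity.NavierStokesRegularity.Theses.TrappingWindowRungThree.RestartControl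
  intro ε₀ θ c η i₀ α X₀ P env K₁ K₂ hε₀ hθ hc hη hX₀ hK₁ hK₂
  exact main hε₀ hθ hc hη hX₀ hK₁ hK₂

open RestartControl in
/-- **Item stmt-NavierStokesRegularity-21750** read in route `ExactWindowRungThree`
(`ExactWindowRungThree.RestartControl`): the same statement, closed by the same tree theorem
`RestartControl.main`. [cite: Tao2016AveragedNS, §6.4 Prop. 6.5 and Lemma 6.7] -/
theorem exactWindowRungThree_restartControl_proof :
    Summit.NavierStokesRegularity.NavierStokesRegularity.Theses.ExactWindowRungThree.RestartControl := by
  unfold Summit.NavierStokesRegularity.NavierStokesRegularity.Theses.ExactWindowRungThree.RestartControl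
  intro ε₀ θ c η i₀ α X₀ P env K₁ K₂ hε₀ hθ hc hη hX₀ hK₁ hK₂
  exact main hε₀ hθ hc hη hX₀ hK₁ hK₂

end Summit.NavierStokesRegularity.NavierStokesRegularity.Theorems

end
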